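import Literature.NumberTheory.Automorphic.ShimuraCurveRibetTakahashiCokernelProofs
import Literature.NumberTheory.Automorphic.ShimuraParametrizationSplitDegreeProofs
import HarnessLib

/-!
# Pasten 2024, the pairwise `gcd`-bounded denominator of `γ_{pq,M,E}`: the printed assembly
# ((EqSequentially) at `d = 1` with Lemmas 6.8, 6.14, 6.15) performed in the tree

Topic `NumberTheory/Automorphic`; a proofs-only companion (theorems only: no definition, no named
fact, nothing restated; D-0026) of `ShimuraCurveRibetTakahashi.lean`, for its named fact
`Literature.NumberTheory.Automorphic.PastenShimura2024_pairwise_denominator` (H. Pasten, *Shimura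
curves and the abc conjecture*, J. Number Theory 254 (2024) 214–335 = arXiv:1705.09251; held arXiv
text, pp. 20–25 read). That fact is, by its own docstring, an ASSEMBLED CONSEQUENCE of four printed
results at the two-prime level `D = pq` (`d = 1`, `m = M` in the notation of §6.9 p. 25):

* (EqSequentially) p. 25 at `d = 1`: "By Proposition 6.13 and Lemma 6.8 we have
  `δ_{d,prm}/δ_{dpr,m} = u_{d,p,r,m}/(i_p(d,prm)² j_r(dpr,m)²) · c_p(E) c_r(E)` where `u_{d,p,r,m}` is
  certain rational number supported on primes `≤ 163` with multiplicative height at most `163`",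
  i.e. Prop. 6.13 p. 23 (= Ribet–Takahashi 1997, Thm. 2: `δ_{1,N}/δ_{pq,M} =
  c_p(A_{1,N}) c_q(A_{pq,M}) / (i_p(1,N)² j_q(pq,M)²)`) with Lemma 6.8 p. 22 (`c_p(A)/c_p(B)` has
  multiplicative height `≤ 163` for `ℚ`-isogenous `A, B` multiplicative at `p`; `c_p(E) = v_p(Δ_E)`,
  §6.4 p. 22);
* Lemma 6.14 p. 23: "if `N = DM` is squarefree away from `S`, and `p` exactly divides `M`, then
  `i_p(J₀^D(M), χ_{D,M})` divides an integer `κ_S` which only depends on the set `S`" — at the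
  factorisation `N = 1 · N`, `p ∥ N`: `i_p(1,N) ∣ κ_S`;
* Lemma 6.15 p. 24: "There is a function `α_{S,1} : 𝒫 → ℤ_{≥0}` supported on primes `≤ 163` …
  Let `E` be an elliptic curve over `ℚ`, semi-stable away from `S`, and of conductor `N`. Let
  `N = DM` be an admissible factorization. If `p, r` are two (possibly equal) primes dividing `D`,
  then for every prime `ℓ` we have `v_ℓ(j_p(D,M)) ≤ v_ℓ(c_r(E)) + α_{S,1}(ℓ)`" — at `D = pq` for
  the cokernel prime `q` against `r = p` and `r = q`: `v_ℓ(j_q(pq,M)) ≤ v_ℓ(gcd(c_p(E), c_q(E))) +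
  α_{S,1}(ℓ)`, so `j_q(pq,M) ∣ κ' · gcd(c_p(E), c_q(E))` with `κ' = ∏_ℓ ℓ^{α_{S,1}(ℓ)}`;

whence `δ_{1,N} · b = a · δ_{pq,M} · c_p(E) c_q(E)` with `a = a₁a₂ ≤ 163²` and
`b = b₁b₂ · i_p(1,N)² · j_q(pq,M)² ≤ 163² κ_S² κ'² · gcd(c_p(E), c_q(E))²` — the fact, with
`κ = 163² κ_S² κ'²` depending only on `S`.

This file PERFORMS that assembly in the tree, over the hypothesis shapes of
`ShimuraCurveRibetTakahashiCokernelProofs.lean` §III (the tree has no Néron models, so the orders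
`i_p(D,M) = # image`, `j_p(D,M) = # cokernel` of `q_{D,M,p,*} : Φ_p(J₀^D(M)) → Φ_p(A_{D,M})`, §6.6
p. 23, are two FUNCTIONS `cI cJ` of the class-minimal datum rendering `q_{D,M}` and of the prime,
the same functions in every instance; `δ_{D,M} = deg P` for a class-minimal datum `P`
(`IsMinimalFor`) on an `X : ShimuraCurveData D M`, `A_{D,M}` = the curve `W'` it parametrises,
`c_p(A) = v_p(Δ_A)`), so that the three Pasten facts of `ShimuraCurveRibetTakahashi.lean` built on
Prop. 6.13 — `PastenShimura2024_thm_6_1`, `PastenShimura2024_thm_6_1_b` and this one — wait on ONE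
common list of external inputs. The `D = 1` bridge between the tree's two renderings of `δ_{1,N}`
(below), a hypothesis `h0` of all the sibling assemblies, is the THEOREM
`ShimuraParametrizationData.IsMinimalFor.deg_eq_modularDegree` of
`ShimuraParametrizationSplitDegreeProofs.lean` and is used as such. What is proved (sorry-free, no
new named fact, no statement of the tree changed):

* `dvd_mul_prod_pow_of_factorization_le`, `dvd_gcd_mul_prod_pow_of_factorization_le` — the flat
  arithmetic of the last step: `v_ℓ(j) ≤ v_ℓ(c_p) + α(ℓ)` and `≤ v_ℓ(c_q) + α(ℓ)` at every prime,
  `α` vanishing for `ℓ ≥ B`, give `j ∣ gcd(c_p, c_q) · ∏_{ℓ < B} ℓ^{α(ℓ)}`;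
* `PastenShimura2024_pairwise_denominator_of_lemmas` — **the fact from its four printed inputs
  exactly as its docstring assembles them**: Prop. 6.13 (`h613`, the sibling files' hypothesis
  verbatim), Lemma 6.8 (`h68`, verbatim), Lemma 6.14 (`h614`: for every finite `S` a `κ_S ≥ 1` with
  `i_p(D,M) ∣ κ_S` for `N = DM` squarefree away from `S` and `p ∥ M`) and Lemma 6.15 (`h615`: for
  every finite `S` a function `α_{S,1}` vanishing at primes `> 163` with
  `v_ℓ(j_p(D,M)) ≤ v_ℓ(c_r(E)) + α_{S,1}(ℓ)` for `p, r ∣ D`), together with the Jacquet–Langlands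
  existence fact `nonempty_shimuraParametrizationData` (`hP`: a class-minimal datum on `X₀^1(N)`,
  Pasten's `q_{1,N}`); constant `κ = 163² κ_S² κ'²`, `κ' = ∏_{ℓ ≤ 163} ℓ^{α_{S,1}(ℓ)}`;
* `PastenShimura2024_pairwise_denominator_of_ribetTakahashi_inputs` — the same with **Lemma 6.15
  PERFORMED** (the tree's `PastenShimura2024_lemma_6_15`, `ShimuraCurveRibetTakahashiCokernelProofs`,
  from `h613`, "`j_p(D,M) ∣ c_p(A_{D,M})` by definition" `hJc`, `h68`, `h614`): inputs `hP`,
  `h613`, `hJc`, `h68`, `h614` (with `κ_S` supported on primes `≤ 163`, as printed);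
* `PastenShimura2024_pairwise_denominator_of_ribetTakahashi_eisenstein_mazurKenku` — **the trust
  base**: the same with **Lemma 6.14 PERFORMED** from the Eisenstein divisibility `hEis`
  ("`i_p(J₀^D(M), χ_{D,M})` divides `r + 1 − a_r(A_{D,M})` for every prime `r ∤ N`", proof of
  Lemma 6.14 p. 23, Ribet) and Lemma 6.7 p. 22 `h67` (the tree's `PastenShimura2024_lemma_6_14`),
  and **Lemma 6.8 DISCHARGED** from the tree's named fact
  `Literature.NumberTheory.EllipticCurves.mazurKenku_exists_cyclic_isogeny` (Mazur 1978 Thm. 1,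
  Kenku 1982; `PastenShimura2024_lemma_6_8_of_mazurKenku'`, `lemma_6_8_factorization_form`);
* `PastenShimura2024_thm_6_1_of_prop_6_13_of_mazurKenku'`,
  `PastenShimura2024_thm_6_1_b_of_ribetTakahashi_eisenstein_mazurKenku'` — **the two sibling facts
  with their bridge `h0` discharged** (the assemblies of `ShimuraCurveRibetTakahashiAssemblyProofs`
  / `ShimuraCurveRibetTakahashiCokernelProofs` fed with `modularDegree_dvd_deg` /
  `IsMinimalFor.deg_dvd_modularDegree`).

So after this file the discharge `PastenShimura2024_pairwise_denominator_holds` waits for exactly: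
(1) the vocabulary of Néron models / component groups `Φ_p` of `J₀^D(M)` and of the optimal quotient
`q_{D,M}` defining `cI`, `cJ`, and over it `h613` (Ribet–Takahashi 1997, Thm. 2 — consumed only at
`d = 1`, `D = pq`), `hJc` (a cokernel into a cyclic group of order `c` has order dividing `c` —
consumed at `D = pq`), `hEis` (Ribet: `Φ_p(J₀^D(M))` is Eisenstein, with the optimality of
`A_{D,M}` — consumed at `D = 1`, i.e. for `J₀(N)`) and `h67` (Pasten's Lemma 6.7: Mazur, Ribet,
Faltings, Chebotarev); (2) the tree's named facts `mazurKenku_exists_cyclic_isogeny` and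
`nonempty_shimuraParametrizationData` (the latter only at `D = 1`). This is the list of
`PastenShimura2024_thm_6_1_b_of_ribetTakahashi_eisenstein_mazurKenku'` MINUS its Diophantine inputs
(Lemmas 6.10–6.12: the fact has no hypothesis on the co-level `M`, so Thm. 6.17 is not on its path —
"NO hypothesis on the co-level `M`, which is the point of this line", docstring of the consumer
`Summits/ABC/ABC/Theorems/RibetTakahashiSplitFewPrimeValuationProductStubTwoPrimePackage`).

**The bridge.** Prop. 6.13 at `d = 1` compares `δ_{pq,M}` with the modular degree `δ_{1,N}` of the
optimal quotient of `J₀^1(N) = J₀(N)` (§2 p. 12: "We will write `X₀^1(N) = X₀(N)` which is the only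
case when `X₀^D(M)` has cuspidal points"). The tree renders `δ_{1,N}` twice (module docstring of
`ShimuraCurveRibetTakahashi.lean`): in the fact, classically, as `D₁.modularDegree` for a classical
datum `D₁ : ModularParametrizationData W₁ N` with the newform of `W` of minimal degree among all
data at level `N` with that newform; in `h613`, as `deg P₁` (`=: δ^{Sh}_{1,N}`) for a class-minimal
Shimura datum `P₁` on an `X₁ : ShimuraCurveData 1 N` (an Eichler order of level `N` in `M₂(ℚ)`, `Γ`
conjugate to `Γ₀(N)`). The sibling files take one divisibility each as their `h0`
(`δ_{1,N} ∣ δ^{Sh}_{1,N}` for the numerator statement, `δ^{Sh}_{1,N} ∣ δ_{1,N}` for part (b)); a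
two-sided bound on `γ_{pq,M,E}` needs both, i.e. the equality `δ^{Sh}_{1,N} = δ_{1,N}`, which is
proved in `ShimuraParametrizationSplitDegreeProofs.lean` (transport of data along
`Γ₀^1(N) = h Γ₀(N) h⁻¹` in both directions with the degree, Atkin–Lehner multiplicity one, the
degree calculus of `ModularCurveManinSemistableProofs`, Faltings).

## References

* H. Pasten, *Shimura curves and the abc conjecture*, J. Number Theory 254 (2024) 214–335 =
  arXiv:1705.09251: §2 p. 12, §6.4 and Lemma 6.8 p. 22, Prop. 6.13 and Lemma 6.14 p. 23,
  Lemma 6.15 p. 24, §6.9 (EqSequentially) p. 25 (held arXiv text, read). [PastenShimura2024]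
* K. A. Ribet, S. Takahashi, *Parametrizations of elliptic curves by Shimura curves and by
  classical modular curves*, PNAS 94 (1997) 11110–11114, Thm. 2. [RibetTakahashi1997]
* B. Mazur, Invent. Math. 44 (1978), Thm. 1 [Mazur1978]; M. A. Kenku, J. Number Theory 15 (1982)
  [Kenku1982].

## Mathlib / tree search

Tree (reused): `PastenShimura2024_lemma_6_15`, `PastenShimura2024_lemma_6_14`,
`factorization_mul_apply`, `one_le_prod_pow_and_primeFactors_lt`,
`factorization_minimalDiscriminantNorm_pos_of_dvd`, `IsAdmissibleFactorization.dvd_and_not_sq_dvd`,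
`isAdmissibleFactorization_one`, `nonempty_shimuraCurveData_holds`,
`ShimuraParametrizationData.exists_isMinimalFor_of_nonempty`, `lemma_6_8_factorization_form`,
`PastenShimura2024_lemma_6_8_of_mazurKenku'`, `PastenShimura2024_thm_6_1_of_prop_6_13_of_mazurKenku`,
`PastenShimura2024_thm_6_1_b_of_ribetTakahashi_eisenstein_mazurKenku`,
`ShimuraParametrizationData.IsMinimalFor.deg_eq_modularDegree`, `.deg_dvd_modularDegree`,
`ShimuraParametrizationData.modularDegree_dvd_deg` (`ShimuraParametrizationSplitDegreeProofs`).
Mathlib: `Nat.factorization_le_iff_dvd`, `Nat.Prime.pow_dvd_iff_le_factorization`,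
`Nat.gcd_mul_right`, `Nat.dvd_gcd`. No component group, Néron model or `J₀^D(M)` exists in Mathlib
or the tree (`lean search 'componentGroup|NeronModel'`).
-/

noncomputable section

open scoped MatrixGroups ModularForm

namespace Literature.NumberTheory.Automorphic

open Literature.NumberTheory.EllipticCurves (mazurKenku_exists_cyclic_isogeny)
open Literature.NumberTheory.EllipticCurves.ModularForms (ModularParametrizationData IsNewformOf
  PastenShimura2024_lemma_6_8_of_mazurKenku')

/-! ## I. Flat arithmetic: from the two valuation bounds of Lemma 6.15 to `j ∣ κ' · gcd` -/

/-- If `v_ℓ(j) ≤ v_ℓ(c) + α(ℓ)` at every prime `ℓ` and `α(ℓ) = 0` for primes `ℓ ≥ B`, then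
`j ∣ c · ∏_{ℓ < B prime} ℓ^{α(ℓ)}` (`j, c ≥ 1`). [folklore] -/
theorem dvd_mul_prod_pow_of_factorization_le {j c B : ℕ} {α : ℕ → ℕ} (hj : j ≠ 0) (hc : c ≠ 0)
    (hle : ∀ ℓ : ℕ, ℓ.Prime → j.factorization ℓ ≤ c.factorization ℓ + α ℓ)
    (hzero : ∀ ℓ : ℕ, ℓ.Prime → B ≤ ℓ → α ℓ = 0) :
    j ∣ c * ∏ ℓ ∈ (Finset.range B).filter Nat.Prime, ℓ ^ α ℓ := by
  set K := ∏ ℓ ∈ (Finset.range B).filter Nat.Prime, ℓ ^ α ℓ with hK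
  have hK0 : K ≠ 0 := Nat.one_le_iff_ne_zero.mp (one_le_prod_pow_and_primeFactors_lt B α).1
  refine (Nat.factorization_le_iff_dvd hj (mul_ne_zero hc hK0)).mp (Finsupp.le_def.mpr fun ℓ => ?_)
  by_cases hℓ : ℓ.Prime
  · have hKℓ : α ℓ ≤ K.factorization ℓ := by
      by_cases hB : ℓ < B
      · exact (hℓ.pow_dvd_iff_le_factorization hK0).mp
          (Finset.dvd_prod_of_mem (fun ℓ => ℓ ^ α ℓ)
            (Finset.mem_filter.mpr ⟨Finset.mem_range.mpr hB, hℓ⟩))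
      · rw [hzero ℓ hℓ (not_lt.mp hB)]
        exact Nat.zero_le _
    rw [factorization_mul_apply hc hK0]
    exact (hle ℓ hℓ).trans (by omega)
  · simp [Nat.factorization_eq_zero_of_not_prime _ hℓ]

/-- **The last step of the assembly (Lemma 6.15 for `r = p` and `r = q`).** If
`v_ℓ(j) ≤ v_ℓ(c_p) + α(ℓ)` and `v_ℓ(j) ≤ v_ℓ(c_q) + α(ℓ)` at every prime `ℓ`, `α(ℓ) = 0` for
primes `ℓ ≥ B`, then `j ∣ gcd(c_p, c_q) · ∏_{ℓ < B prime} ℓ^{α(ℓ)}`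
(`v_ℓ(gcd) = min(v_ℓ(c_p), v_ℓ(c_q))`). [cite: PastenShimura2024, Lemma 6.15 p. 24 (applied with r = p and r = q)] -/
theorem dvd_gcd_mul_prod_pow_of_factorization_le {j cp cq B : ℕ} {α : ℕ → ℕ} (hj : j ≠ 0)
    (hcp : cp ≠ 0) (hcq : cq ≠ 0)
    (hp : ∀ ℓ : ℕ, ℓ.Prime → j.factorization ℓ ≤ cp.factorization ℓ + α ℓ)
    (hq : ∀ ℓ : ℕ, ℓ.Prime → j.factorization ℓ ≤ cq.factorization ℓ + α ℓ)
    (hzero : ∀ ℓ : ℕ, ℓ.Prime → B ≤ ℓ → α ℓ = 0) :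
    j ∣ Nat.gcd cp cq * ∏ ℓ ∈ (Finset.range B).filter Nat.Prime, ℓ ^ α ℓ := by
  rw [← Nat.gcd_mul_right]
  exact Nat.dvd_gcd (dvd_mul_prod_pow_of_factorization_le hj hcp hp hzero)
    (dvd_mul_prod_pow_of_factorization_le hj hcq hq hzero)

/-! ## II. The fact from its four printed inputs (Prop. 6.13, Lemmas 6.8, 6.14, 6.15) -/

/-- **Pasten 2024, the pairwise `gcd`-bounded denominator of `γ_{pq,M,E}`, assembled exactly as the
docstring of `PastenShimura2024_pairwise_denominator` assembles it** (§6.9 (EqSequentially) p. 25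
with `d = 1`, Lemma 6.8 p. 22, Lemma 6.14 p. 23, Lemma 6.15 p. 24). Inputs, as explicit hypotheses
because they are not declarations of the tree (shapes of `ShimuraCurveRibetTakahashiCokernelProofs`
§III, `cI cJ` = the orders `i_p(D,M)`, `j_p(D,M)` of §6.6 p. 23 attached to the class-minimal datum
rendering `q_{D,M}`):

* (`h613`) Prop. 6.13 = Ribet–Takahashi 1997, Thm. 2 (p. 23: for `D = dpr`,
  `δ_{d,prM} · i_p(d,prM)² · j_r(dpr,M)² = δ_{dpr,M} · c_p(A_{d,prM}) · c_r(A_{dpr,M})`), used at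
  `d = 1`, `D = pq`;
* (`h68`) Lemma 6.8 p. 22 in the idiom `v_p(Δ_{W'}) · b = a · v_p(Δ_W)`, `1 ≤ a, b ≤ 163`, for
  `W ∼ W'` and `p ∥ N_W` (the sibling files' hypothesis verbatim);
* (`h614`) Lemma 6.14 p. 23: for every finite `S` an integer `κ_S ≥ 1` with `i_p(D,M) ∣ κ_S`
  whenever `N = DM` is squarefree away from `S` and `p ∥ M` — used at `N = 1 · N`, `p ∥ N`;
* (`h615`) Lemma 6.15 p. 24: for every finite `S` a function `α_{S,1}` vanishing at primes `> 163`
  with `v_ℓ(j_p(D,M)) ≤ v_ℓ(c_r(E)) + α_{S,1}(ℓ)` for `E` semistable away from `S`, `N = DM`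
  admissible, `p, r ∣ D`, `ℓ` prime — used at `D = pq` for `j_q(pq,M)` against `r = p`, `r = q`;
* (`hP`) the Jacquet–Langlands existence fact `nonempty_shimuraParametrizationData` (§2 p. 12: a
  datum of `W` on `X₀^1(N)`, hence a class-minimal one, Pasten's `q_{1,N} j_N`);

and the `D = 1` bridge `δ^{Sh}_{1,N} = δ_{1,N}` between the tree's two renderings of `δ_{1,N}`, now
a THEOREM (`ShimuraParametrizationData.IsMinimalFor.deg_eq_modularDegree`,
`ShimuraParametrizationSplitDegreeProofs`).

Proof as in the fact's docstring: `δ_{1,N} i² j² = δ_{pq,M} c_p(A_{1,N}) c_q(A_{pq,M})` (`h613`),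
`c_p(A_{1,N}) b₁ = a₁ c_p(E)`, `c_q(A_{pq,M}) b₂ = a₂ c_q(E)` (`h68`), `i ∣ κ_S` (`h614`),
`j ∣ κ' gcd(c_p(E), c_q(E))` (`h615` twice, `dvd_gcd_mul_prod_pow_of_factorization_le`,
`κ' = ∏_{ℓ ≤ 163} ℓ^{α_{S,1}(ℓ)}`); so `a = a₁a₂ ≤ 163²`, `b = i²j²b₁b₂ ≤ (163² κ_S² κ'²) · gcd²`.
[cite: PastenShimura2024, §6.9 (EqSequentially) p. 25 with d = 1, Prop. 6.13 p. 23, Lemma 6.8 p. 22, Lemma 6.14 p. 23, Lemma 6.15 p. 24] -/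
theorem PastenShimura2024_pairwise_denominator_of_lemmas
    (hP : nonempty_shimuraParametrizationData)
    (cI cJ : ∀ {D M : ℕ} {X : ShimuraCurveData D M} {W' : WeierstrassCurve ℚ},
      ShimuraParametrizationData X W' → ℕ → ℕ)
    (hI : ∀ {D M : ℕ} {X : ShimuraCurveData D M} {W' : WeierstrassCurve ℚ}
      (P : ShimuraParametrizationData X W') (p : ℕ), 0 < cI P p)
    (hJ : ∀ {D M : ℕ} {X : ShimuraCurveData D M} {W' : WeierstrassCurve ℚ}
      (P : ShimuraParametrizationData X W') (p : ℕ), 0 < cJ P p)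
    (h613 : ∀ {N d M₁ D M p r : ℕ}, p.Prime → r.Prime → p ≠ r → D = d * (p * r) →
      M₁ = p * r * M → IsAdmissibleFactorization N D M →
      ∀ (X₁ : ShimuraCurveData d M₁) (X₂ : ShimuraCurveData D M)
        (W : WeierstrassCurve ℚ) [W.IsElliptic] [W.IsGloballyMinimal], W.conductorNorm ℤ = N →
      ∀ (W₁' : WeierstrassCurve ℚ) [W₁'.IsElliptic] (P₁ : ShimuraParametrizationData X₁ W₁'),
        P₁.IsMinimalFor W →
      ∀ (W₂' : WeierstrassCurve ℚ) [W₂'.IsElliptic] (P₂ : ShimuraParametrizationData X₂ W₂'),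
        P₂.IsMinimalFor W →
        P₁.deg * (cI P₁ p ^ 2 * cJ P₂ r ^ 2) =
          P₂.deg * ((W₁'.minimalDiscriminantNorm ℤ).factorization p *
            (W₂'.minimalDiscriminantNorm ℤ).factorization r))
    (h68 : ∀ (W W' : WeierstrassCurve ℚ) [W.IsElliptic] [W'.IsElliptic], W.IsIsogenous W' →
      ∀ p : ℕ, p.Prime → p ∣ W.conductorNorm ℤ → ¬ p ^ 2 ∣ W.conductorNorm ℤ →
        ∃ a b : ℕ, 0 < a ∧ a ≤ 163 ∧ 0 < b ∧ b ≤ 163 ∧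
          (W'.minimalDiscriminantNorm ℤ).factorization p * b =
            a * (W.minimalDiscriminantNorm ℤ).factorization p)
    (h614 : ∀ S : Finset ℕ, ∃ κ₁ : ℕ, 1 ≤ κ₁ ∧
      ∀ {N D M : ℕ}, IsAdmissibleFactorization N D M →
      ∀ (X : ShimuraCurveData D M) (W : WeierstrassCurve ℚ) [W.IsElliptic] [W.IsGloballyMinimal],
        W.conductorNorm ℤ = N → (∀ q : ℕ, q.Prime → q ∉ S → ¬ q ^ 2 ∣ N) →
      ∀ (W' : WeierstrassCurve ℚ) [W'.IsElliptic] (P : ShimuraParametrizationData X W'),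
        P.IsMinimalFor W → ∀ p : ℕ, p.Prime → p ∣ M → ¬ p ^ 2 ∣ M → cI P p ∣ κ₁)
    (h615 : ∀ S : Finset ℕ, ∃ α : ℕ → ℕ, (∀ ℓ : ℕ, ℓ.Prime → 164 ≤ ℓ → α ℓ = 0) ∧
      ∀ {N D M : ℕ}, IsAdmissibleFactorization N D M →
      ∀ (X : ShimuraCurveData D M) (W : WeierstrassCurve ℚ) [W.IsElliptic] [W.IsGloballyMinimal],
        W.conductorNorm ℤ = N → (∀ q : ℕ, q.Prime → q ∉ S → ¬ q ^ 2 ∣ N) →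
      ∀ (W' : WeierstrassCurve ℚ) [W'.IsElliptic] (P : ShimuraParametrizationData X W'),
        P.IsMinimalFor W → ∀ {p r : ℕ}, p.Prime → r.Prime → p ∣ D → r ∣ D →
        ∀ ℓ : ℕ, ℓ.Prime → (cJ P p).factorization ℓ ≤
          ((W.minimalDiscriminantNorm ℤ).factorization r).factorization ℓ + α ℓ) :
    PastenShimura2024_pairwise_denominator := by
  intro S
  obtain ⟨κ₁, hκ₁, h614S⟩ := h614 S
  obtain ⟨α, hα0, h615S⟩ := h615 S
  -- the constant `κ' = ∏_{ℓ ≤ 163} ℓ^{α_{S,1}(ℓ)}` of Lemma 6.15, and `κ = 163² κ_S² κ'²`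
  set K := ∏ ℓ ∈ (Finset.range 164).filter Nat.Prime, ℓ ^ α ℓ with hK
  have hK1 : 1 ≤ K := (one_le_prod_pow_and_primeFactors_lt 164 α).1
  refine ⟨163 ^ 2 * κ₁ ^ 2 * K ^ 2, Nat.one_le_iff_ne_zero.mpr (mul_ne_zero (mul_ne_zero
    (pow_ne_zero 2 (by norm_num)) (pow_ne_zero 2 (by omega))) (pow_ne_zero 2 (by omega))), ?_⟩
  intro N M p q _ hp hq hpq hadm X W _ _ hWN hS W₁ _ D₁ hf hmin W' _ P hPm
  -- `p, q ∥ N`, so `c_p(E), c_q(E) ≥ 1`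
  have hpD : p ∣ p * q := Dvd.intro q rfl
  have hqD : q ∣ p * q := Dvd.intro_left p rfl
  obtain ⟨hpN, hp2N⟩ := hadm.dvd_and_not_sq_dvd hp hpD
  obtain ⟨hqN, hq2N⟩ := hadm.dvd_and_not_sq_dvd hq hqD
  have hpN' : p ∣ W.conductorNorm ℤ := hWN ▸ hpN
  have hp2N' : ¬ p ^ 2 ∣ W.conductorNorm ℤ := hWN ▸ hp2N
  have hqN' : q ∣ W.conductorNorm ℤ := hWN ▸ hqN
  have hq2N' : ¬ q ^ 2 ∣ W.conductorNorm ℤ := hWN ▸ hq2N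
  have hcpE := factorization_minimalDiscriminantNorm_pos_of_dvd W hp hpN'
  have hcqE := factorization_minimalDiscriminantNorm_pos_of_dvd W hq hqN'
  -- the level `(1, N)`: `X₀^1(N)`, a class-minimal datum on it (`q_{1,N}`), and the bridge
  have hadm₁ : IsAdmissibleFactorization N 1 N := isAdmissibleFactorization_one hadm.pos
  obtain ⟨X₁⟩ := nonempty_shimuraCurveData_holds hadm₁
  obtain ⟨W₁', hW₁', P₁, hP₁⟩ :=
    ShimuraParametrizationData.exists_isMinimalFor_of_nonempty (hP hadm₁ X₁ W hWN)
  have hδ : P₁.deg = D₁.modularDegree := hP₁.deg_eq_modularDegree D₁ hf hmin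
  -- Prop. 6.13 at `d = 1`, `D = pq`: `δ_{1,N} i_p(1,N)² j_q(pq,M)² = δ_{pq,M} c_p(A_{1,N}) c_q(A_{pq,M})`
  have e613 := h613 hp hq hpq (one_mul (p * q)).symm hadm.mul_eq.symm hadm X₁ X W hWN W₁' P₁ hP₁
    W' P hPm
  -- Lemma 6.14: `i_p(1,N) ∣ κ_S` (`N = 1 · N` squarefree away from `S`, `p ∥ N`)
  have hi : cI P₁ p ∣ κ₁ := h614S hadm₁ X₁ W hWN hS W₁' P₁ hP₁ p hp hpN hp2N
  -- Lemma 6.15 at `D = pq` for `j_q(pq,M)`, against `r = p` and `r = q`: `j ∣ κ' gcd(c_p, c_q)`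
  have hjdvd : cJ P q ∣ Nat.gcd ((W.minimalDiscriminantNorm ℤ).factorization p)
      ((W.minimalDiscriminantNorm ℤ).factorization q) * K :=
    dvd_gcd_mul_prod_pow_of_factorization_le (hJ P q).ne' hcpE.ne' hcqE.ne'
      (h615S hadm X W hWN hS W' P hPm hq hp hqD hpD) (h615S hadm X W hWN hS W' P hPm hq hq hqD hqD)
      hα0
  -- Lemma 6.8 for `A_{1,N}` at `p` and `A_{pq,M}` at `q`
  obtain ⟨a₁, b₁, ha₁, ha₁', hb₁, hb₁', e₁⟩ := h68 W W₁' hP₁.1 p hp hpN' hp2N'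
  obtain ⟨a₂, b₂, ha₂, ha₂', hb₂, hb₂', e₂⟩ := h68 W W' hPm.1 q hq hqN' hq2N'
  set i := cI P₁ p
  set j := cJ P q
  set cp := (W.minimalDiscriminantNorm ℤ).factorization p
  set cq := (W.minimalDiscriminantNorm ℤ).factorization q
  set c₁ := (W₁'.minimalDiscriminantNorm ℤ).factorization p
  set c₂ := (W'.minimalDiscriminantNorm ℤ).factorization q
  set g := Nat.gcd cp cq
  have hile : i ≤ κ₁ := Nat.le_of_dvd hκ₁ hi
  have hjle : j ≤ g * K := Nat.le_of_dvd (Nat.mul_pos (Nat.gcd_pos_of_pos_left _ hcpE) hK1) hjdvd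
  refine ⟨a₁ * a₂, i ^ 2 * j ^ 2 * (b₁ * b₂), Nat.mul_pos ha₁ ha₂,
    Nat.mul_pos (Nat.mul_pos (pow_pos (hI P₁ p) 2) (pow_pos (hJ P q) 2)) (Nat.mul_pos hb₁ hb₂),
    ?_, ?_, ?_⟩
  · -- `a = a₁ a₂ ≤ 163²`
    rw [sq]
    exact Nat.mul_le_mul ha₁' ha₂'
  · -- `b = i² j² b₁ b₂ ≤ κ_S² (κ' gcd)² 163² = κ gcd²`
    calc i ^ 2 * j ^ 2 * (b₁ * b₂) ≤ κ₁ ^ 2 * (g * K) ^ 2 * (163 * 163) :=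
          Nat.mul_le_mul (Nat.mul_le_mul (Nat.pow_le_pow_left hile 2) (Nat.pow_le_pow_left hjle 2))
            (Nat.mul_le_mul hb₁' hb₂')
      _ = 163 ^ 2 * κ₁ ^ 2 * K ^ 2 * g ^ 2 := by ring
  · -- the identity `δ_{1,N} b = a δ_{pq,M} c_p(E) c_q(E)`
    calc D₁.modularDegree * (i ^ 2 * j ^ 2 * (b₁ * b₂))
        = P₁.deg * (i ^ 2 * j ^ 2) * (b₁ * b₂) := by rw [← hδ]; ring
      _ = P.deg * (c₁ * c₂) * (b₁ * b₂) := by rw [e613]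
      _ = P.deg * ((c₁ * b₁) * (c₂ * b₂)) := by ring
      _ = P.deg * ((a₁ * cp) * (a₂ * cq)) := by rw [e₁, e₂]
      _ = a₁ * a₂ * P.deg * (cp * cq) := by ring

/-! ## III. Lemma 6.15 performed: the fact from Prop. 6.13, `j ∣ #Φ`, Lemma 6.8, Lemma 6.14 -/

/-- **Pasten 2024, the pairwise denominator from Ribet–Takahashi's Prop. 6.13, "`j_p ∣ c_p(A_{D,M})`
by definition", Lemma 6.8, Lemma 6.14, the Jacquet–Langlands fact and the `D = 1` bridge** —
`PastenShimura2024_pairwise_denominator_of_lemmas` with Lemma 6.15 PROVED in the tree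
(`PastenShimura2024_lemma_6_15`, `ShimuraCurveRibetTakahashiCokernelProofs`: `p = r` — `hJc` and
Lemma 6.8; `p ≠ r` — the two expressions of Prop. 6.13 for `δ_{D/(pr),prM}/δ_{D,M}`, Lemma 6.8 and
Lemma 6.14), with the explicit `α_{S,1}(ℓ) = v_ℓ(κ_S) + 3 log_ℓ 163`, which vanishes at primes
`ℓ > 163` because `κ_S` is supported on primes `≤ 163` (as printed in Lemma 6.14, and required of
`h614` here). [cite: PastenShimura2024, §6.9 (EqSequentially) p. 25 with d = 1, Prop. 6.13 and Lemma 6.14 p. 23, Lemma 6.15 p. 24 (statement and proof), Lemma 6.8 p. 22] -/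
theorem PastenShimura2024_pairwise_denominator_of_ribetTakahashi_inputs
    (hP : nonempty_shimuraParametrizationData)
    (cI cJ : ∀ {D M : ℕ} {X : ShimuraCurveData D M} {W' : WeierstrassCurve ℚ},
      ShimuraParametrizationData X W' → ℕ → ℕ)
    (hI : ∀ {D M : ℕ} {X : ShimuraCurveData D M} {W' : WeierstrassCurve ℚ}
      (P : ShimuraParametrizationData X W') (p : ℕ), 0 < cI P p)
    (hJ : ∀ {D M : ℕ} {X : ShimuraCurveData D M} {W' : WeierstrassCurve ℚ}
      (P : ShimuraParametrizationData X W') (p : ℕ), 0 < cJ P p)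
    (h613 : ∀ {N d M₁ D M p r : ℕ}, p.Prime → r.Prime → p ≠ r → D = d * (p * r) →
      M₁ = p * r * M → IsAdmissibleFactorization N D M →
      ∀ (X₁ : ShimuraCurveData d M₁) (X₂ : ShimuraCurveData D M)
        (W : WeierstrassCurve ℚ) [W.IsElliptic] [W.IsGloballyMinimal], W.conductorNorm ℤ = N →
      ∀ (W₁' : WeierstrassCurve ℚ) [W₁'.IsElliptic] (P₁ : ShimuraParametrizationData X₁ W₁'),
        P₁.IsMinimalFor W →
      ∀ (W₂' : WeierstrassCurve ℚ) [W₂'.IsElliptic] (P₂ : ShimuraParametrizationData X₂ W₂'),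
        P₂.IsMinimalFor W →
        P₁.deg * (cI P₁ p ^ 2 * cJ P₂ r ^ 2) =
          P₂.deg * ((W₁'.minimalDiscriminantNorm ℤ).factorization p *
            (W₂'.minimalDiscriminantNorm ℤ).factorization r))
    (hJc : ∀ {N D M : ℕ}, IsAdmissibleFactorization N D M →
      ∀ (X : ShimuraCurveData D M) (W : WeierstrassCurve ℚ) [W.IsElliptic] [W.IsGloballyMinimal],
        W.conductorNorm ℤ = N →
      ∀ (W' : WeierstrassCurve ℚ) [W'.IsElliptic] (P : ShimuraParametrizationData X W'),
        P.IsMinimalFor W → ∀ p : ℕ, p.Prime → p ∣ D →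
        cJ P p ∣ (W'.minimalDiscriminantNorm ℤ).factorization p)
    (h68 : ∀ (W W' : WeierstrassCurve ℚ) [W.IsElliptic] [W'.IsElliptic], W.IsIsogenous W' →
      ∀ p : ℕ, p.Prime → p ∣ W.conductorNorm ℤ → ¬ p ^ 2 ∣ W.conductorNorm ℤ →
        ∃ a b : ℕ, 0 < a ∧ a ≤ 163 ∧ 0 < b ∧ b ≤ 163 ∧
          (W'.minimalDiscriminantNorm ℤ).factorization p * b =
            a * (W.minimalDiscriminantNorm ℤ).factorization p)
    (h614 : ∀ S : Finset ℕ, ∃ κ₁ : ℕ, 1 ≤ κ₁ ∧ (∀ q ∈ κ₁.primeFactors, q ≤ 163) ∧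
      ∀ {N D M : ℕ}, IsAdmissibleFactorization N D M →
      ∀ (X : ShimuraCurveData D M) (W : WeierstrassCurve ℚ) [W.IsElliptic] [W.IsGloballyMinimal],
        W.conductorNorm ℤ = N → (∀ q : ℕ, q.Prime → q ∉ S → ¬ q ^ 2 ∣ N) →
      ∀ (W' : WeierstrassCurve ℚ) [W'.IsElliptic] (P : ShimuraParametrizationData X W'),
        P.IsMinimalFor W → ∀ p : ℕ, p.Prime → p ∣ M → ¬ p ^ 2 ∣ M → cI P p ∣ κ₁) :
    PastenShimura2024_pairwise_denominator := by
  refine PastenShimura2024_pairwise_denominator_of_lemmas hP cI cJ hI hJ h613 h68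
    (fun S => ?_) (fun S => ?_)
  · obtain ⟨κ₁, hκ₁, -, h614S⟩ := h614 S
    exact ⟨κ₁, hκ₁, h614S⟩
  · obtain ⟨κ₁, hκ₁, hκ₁', h614S⟩ := h614 S
    refine ⟨fun ℓ => κ₁.factorization ℓ + 3 * Nat.log ℓ 163, fun ℓ hℓ h164 => ?_, ?_⟩
    · -- `α_{S,1}(ℓ) = v_ℓ(κ_S) + 3 log_ℓ 163 = 0` for `ℓ ≥ 164`
      have h1 : κ₁.factorization ℓ = 0 := by
        apply Finsupp.notMem_support_iff.mp
        rw [Nat.support_factorization]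
        exact fun hmem => absurd (hκ₁' ℓ hmem) (by omega)
      have h2 : Nat.log ℓ 163 = 0 := Nat.log_of_lt (by omega)
      show κ₁.factorization ℓ + 3 * Nat.log ℓ 163 = 0
      rw [h1, h2]
    · intro N D M hadm X W _ _ hWN hS W' _ P hPm p r hp hr hpD hrD ℓ _
      have h15 := PastenShimura2024_lemma_6_15 cI cJ hI hJ h613 hJc h68 (by omega) h614S hP hadm X W
        hWN hS W' P hPm hp hr hpD hrD ℓ
      show _ ≤ _ + (κ₁.factorization ℓ + 3 * Nat.log ℓ 163)
      omega

/-! ## IV. The trust base: Lemma 6.14 performed and Lemma 6.8 discharged (Prop. 6.13, the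
Eisenstein property, Lemma 6.7, `j ∣ #Φ`, Mazur–Kenku, Jacquet–Langlands) -/

/-- **Pasten 2024, the pairwise `gcd`-bounded denominator of `γ_{pq,M,E}` over the tree's facts —
the exact list of external inputs.**
`PastenShimura2024_pairwise_denominator_of_ribetTakahashi_inputs` with Lemma 6.14 PROVED
from the Eisenstein divisibility `hEis` ("`i_p(J₀^D(M), χ_{D,M})` divides `r + 1 − a_r(A_{D,M})` for
every prime `r ∤ N`", proof of Lemma 6.14 p. 23, with `a_r(A_{D,M})` = the tree's `W'.LFunction r`)
and Lemma 6.7 p. 22 `h67` at every finite `S` (the tree's `PastenShimura2024_lemma_6_14`), and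
Lemma 6.8 PROVED from the tree's named fact `mazurKenku_exists_cyclic_isogeny` (Mazur 1978 Thm. 1,
Kenku 1982; `PastenShimura2024_lemma_6_8_of_mazurKenku'`, `lemma_6_8_factorization_form`), and
the `D = 1` bridge a THEOREM (`ShimuraParametrizationData.IsMinimalFor.deg_eq_modularDegree`). So
the discharge `PastenShimura2024_pairwise_denominator_holds` waits exactly for: the vocabulary of
Néron models / component groups `Φ_p` of `J₀^D(M)` and of the optimal quotient `q_{D,M}` defining
`cI`, `cJ`, and over it `h613` (Ribet–Takahashi 1997, Thm. 2 — consumed only at `d = 1`,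
`D = pq`), `hJc` (a cokernel into a cyclic group of order `c` has order dividing `c` — consumed at
`D = pq`), `hEis` (Ribet: `Φ_p(J₀^D(M))` is Eisenstein, with the optimality of `A_{D,M}` —
consumed at `D = 1`, i.e. for `J₀(N)`) and `h67` (Pasten's Lemma 6.7: Mazur, Ribet, Faltings,
Chebotarev); and the tree's named facts `mazurKenku_exists_cyclic_isogeny` and
`nonempty_shimuraParametrizationData` (the latter only at `D = 1`, Pasten's `q_{1,N}`). Pasten's
own §6.6–6.9, the Diophantine Lemmas 6.10–6.12 and the `D = 1` bridge are not among them.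
[cite: PastenShimura2024, §6.9 (EqSequentially) p. 25 with d = 1, §6.3 Lemma 6.7 and §6.4 Lemma 6.8 p. 22, Prop. 6.13 and Lemma 6.14 p. 23, Lemma 6.15 p. 24] [cite: RibetTakahashi1997, Thm. 2] [cite: Mazur1978, Thm. 1] [cite: Kenku1982] -/
theorem PastenShimura2024_pairwise_denominator_of_ribetTakahashi_eisenstein_mazurKenku
    (hMK : mazurKenku_exists_cyclic_isogeny) (hP : nonempty_shimuraParametrizationData)
    (cI cJ : ∀ {D M : ℕ} {X : ShimuraCurveData D M} {W' : WeierstrassCurve ℚ},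
      ShimuraParametrizationData X W' → ℕ → ℕ)
    (hI : ∀ {D M : ℕ} {X : ShimuraCurveData D M} {W' : WeierstrassCurve ℚ}
      (P : ShimuraParametrizationData X W') (p : ℕ), 0 < cI P p)
    (hJ : ∀ {D M : ℕ} {X : ShimuraCurveData D M} {W' : WeierstrassCurve ℚ}
      (P : ShimuraParametrizationData X W') (p : ℕ), 0 < cJ P p)
    (h613 : ∀ {N d M₁ D M p r : ℕ}, p.Prime → r.Prime → p ≠ r → D = d * (p * r) →
      M₁ = p * r * M → IsAdmissibleFactorization N D M →
      ∀ (X₁ : ShimuraCurveData d M₁) (X₂ : ShimuraCurveData D M)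
        (W : WeierstrassCurve ℚ) [W.IsElliptic] [W.IsGloballyMinimal], W.conductorNorm ℤ = N →
      ∀ (W₁' : WeierstrassCurve ℚ) [W₁'.IsElliptic] (P₁ : ShimuraParametrizationData X₁ W₁'),
        P₁.IsMinimalFor W →
      ∀ (W₂' : WeierstrassCurve ℚ) [W₂'.IsElliptic] (P₂ : ShimuraParametrizationData X₂ W₂'),
        P₂.IsMinimalFor W →
        P₁.deg * (cI P₁ p ^ 2 * cJ P₂ r ^ 2) =
          P₂.deg * ((W₁'.minimalDiscriminantNorm ℤ).factorization p *
            (W₂'.minimalDiscriminantNorm ℤ).factorization r))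
    (hJc : ∀ {N D M : ℕ}, IsAdmissibleFactorization N D M →
      ∀ (X : ShimuraCurveData D M) (W : WeierstrassCurve ℚ) [W.IsElliptic] [W.IsGloballyMinimal],
        W.conductorNorm ℤ = N →
      ∀ (W' : WeierstrassCurve ℚ) [W'.IsElliptic] (P : ShimuraParametrizationData X W'),
        P.IsMinimalFor W → ∀ p : ℕ, p.Prime → p ∣ D →
        cJ P p ∣ (W'.minimalDiscriminantNorm ℤ).factorization p)
    (hEis : ∀ {N D M : ℕ}, IsAdmissibleFactorization N D M →
      ∀ (X : ShimuraCurveData D M) (W : WeierstrassCurve ℚ) [W.IsElliptic] [W.IsGloballyMinimal],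
        W.conductorNorm ℤ = N →
      ∀ (W' : WeierstrassCurve ℚ) [W'.IsElliptic] (P : ShimuraParametrizationData X W'),
        P.IsMinimalFor W → ∀ p : ℕ, p.Prime → p ∣ M → ¬ p ^ 2 ∣ M →
        ∀ r : ℕ, r.Prime → ¬ r ∣ N → (cI P p : ℤ) ∣ (r + 1 : ℤ) - W'.LFunction r)
    (h67 : ∀ (S : Finset ℕ) (ℓ : ℕ), ℓ.Prime → ∃ β : ℕ, (163 < ℓ → β = 1) ∧
      ∀ (A : WeierstrassCurve ℚ) [A.IsElliptic],
        (∀ q : ℕ, q.Prime → q ∉ S → ¬ q ^ 2 ∣ A.conductorNorm ℤ) →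
        ∀ r₀ : ℕ, ∃ r : ℕ, r₀ < r ∧ r.Prime ∧ ¬ ((ℓ ^ β : ℕ) : ℤ) ∣ (r + 1 : ℤ) - A.LFunction r) :
    PastenShimura2024_pairwise_denominator :=
  PastenShimura2024_pairwise_denominator_of_ribetTakahashi_inputs hP cI cJ hI hJ h613 hJc
    (fun W W' _ _ hiso p hp hpN hp2 =>
      lemma_6_8_factorization_form (PastenShimura2024_lemma_6_8_of_mazurKenku' hMK) W W' hiso p hp
        hpN hp2)
    (fun S => PastenShimura2024_lemma_6_14 cI hI hEis (h67 S))

/-! ## V. The siblings with their `D = 1` bridge discharged -/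

/-- **Pasten 2024, Thm. 6.1 (numerator of `γ_{D,M,E}`) from Prop. 6.13, Mazur–Kenku and
Jacquet–Langlands — the `D = 1` bridge discharged.** The sibling
`PastenShimura2024_thm_6_1_of_prop_6_13_of_mazurKenku` (`ShimuraCurveRibetTakahashiAssemblyProofs`)
takes the bridge `h0` — `δ_{1,N} ∣ deg P` for a class-minimal Shimura datum `P` on an
`X : ShimuraCurveData 1 N` — as a hypothesis; it is the THEOREM
`ShimuraParametrizationData.modularDegree_dvd_deg` (`ShimuraParametrizationSplitDegreeProofs`). So
the discharge of `PastenShimura2024_thm_6_1` waits exactly for Mazur–Kenku, the Jacquet–Langlands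
existence `nonempty_shimuraParametrizationData` and Prop. 6.13 `h613` (Ribet–Takahashi 1997 Thm. 2,
with `i_p, j_r ≥ 1` existential). [cite: PastenShimura2024, Thm. 6.1 p. 20, proof §6.9 p. 25, Prop. 6.13 p. 23, Lemma 6.8 p. 22, §2 p. 12] [cite: RibetTakahashi1997, Thm. 2] [cite: Mazur1978, Thm. 1] [cite: Kenku1982] -/
theorem PastenShimura2024_thm_6_1_of_prop_6_13_of_mazurKenku'
    (hMK : mazurKenku_exists_cyclic_isogeny) (hP : nonempty_shimuraParametrizationData)
    (h613 : ∀ {N D M d p r : ℕ}, p.Prime → r.Prime → p ≠ r → D = d * (p * r) →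
      IsAdmissibleFactorization N D M →
      ∀ (X₁ : ShimuraCurveData d (p * r * M)) (X₂ : ShimuraCurveData D M)
        (W : WeierstrassCurve ℚ) [W.IsElliptic] [W.IsGloballyMinimal], W.conductorNorm ℤ = N →
      ∀ (W₁' : WeierstrassCurve ℚ) [W₁'.IsElliptic] (P₁ : ShimuraParametrizationData X₁ W₁'),
        P₁.IsMinimalFor W →
      ∀ (W₂' : WeierstrassCurve ℚ) [W₂'.IsElliptic] (P₂ : ShimuraParametrizationData X₂ W₂'),
        P₂.IsMinimalFor W →
        ∃ i j : ℕ, 0 < i ∧ 0 < j ∧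
          P₁.deg * (i ^ 2 * j ^ 2) = P₂.deg *
            ((W₁'.minimalDiscriminantNorm ℤ).factorization p *
              (W₂'.minimalDiscriminantNorm ℤ).factorization r)) :
    PastenShimura2024_thm_6_1 :=
  PastenShimura2024_thm_6_1_of_prop_6_13_of_mazurKenku hMK hP
    (fun _ _ _ _ _ _ _ D₁ hf hmin _ _ P hPm => P.modularDegree_dvd_deg hPm.1 D₁ hf hmin) h613

/-- **Pasten 2024, Thm. 6.1 (b) from Ribet–Takahashi's Prop. 6.13, the Eisenstein property,
Lemma 6.7, `j ∣ #Φ`, Mazur–Kenku, Lemmas 6.10–6.12 and Jacquet–Langlands — the `D = 1` bridge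
discharged.** The sibling `PastenShimura2024_thm_6_1_b_of_ribetTakahashi_eisenstein_mazurKenku`
(`ShimuraCurveRibetTakahashiCokernelProofs`) takes the bridge `h0` — in the classes (b.1)/(b.2),
`deg P ∣ δ_{1,N}` for a class-minimal Shimura datum `P` on an `X : ShimuraCurveData 1 N` — as a
hypothesis; it is the THEOREM `ShimuraParametrizationData.IsMinimalFor.deg_dvd_modularDegree`
(`ShimuraParametrizationSplitDegreeProofs`, in every class). So the discharge of
`PastenShimura2024_thm_6_1_b` waits exactly for the vocabulary of Néron models / component groups
defining `cI`, `cJ` and over it `h613`, `hJc`, `hEis`, `h67`; the Diophantine `h610`–`h612`; and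
the named facts `mazurKenku_exists_cyclic_isogeny`, `nonempty_shimuraParametrizationData`.
[cite: PastenShimura2024, Thm. 6.1 (b) p. 20, §6.3–6.9 pp. 21–25, §2 p. 12] [cite: RibetTakahashi1997, Thm. 2] [cite: Mazur1978, Thm. 1] [cite: Kenku1982] -/
theorem PastenShimura2024_thm_6_1_b_of_ribetTakahashi_eisenstein_mazurKenku'
    (hMK : mazurKenku_exists_cyclic_isogeny) (hP : nonempty_shimuraParametrizationData)
    (cI cJ : ∀ {D M : ℕ} {X : ShimuraCurveData D M} {W' : WeierstrassCurve ℚ},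
      ShimuraParametrizationData X W' → ℕ → ℕ)
    (hI : ∀ {D M : ℕ} {X : ShimuraCurveData D M} {W' : WeierstrassCurve ℚ}
      (P : ShimuraParametrizationData X W') (p : ℕ), 0 < cI P p)
    (hJ : ∀ {D M : ℕ} {X : ShimuraCurveData D M} {W' : WeierstrassCurve ℚ}
      (P : ShimuraParametrizationData X W') (p : ℕ), 0 < cJ P p)
    (h613 : ∀ {N d M₁ D M p r : ℕ}, p.Prime → r.Prime → p ≠ r → D = d * (p * r) →
      M₁ = p * r * M → IsAdmissibleFactorization N D M →
      ∀ (X₁ : ShimuraCurveData d M₁) (X₂ : ShimuraCurveData D M)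
        (W : WeierstrassCurve ℚ) [W.IsElliptic] [W.IsGloballyMinimal], W.conductorNorm ℤ = N →
      ∀ (W₁' : WeierstrassCurve ℚ) [W₁'.IsElliptic] (P₁ : ShimuraParametrizationData X₁ W₁'),
        P₁.IsMinimalFor W →
      ∀ (W₂' : WeierstrassCurve ℚ) [W₂'.IsElliptic] (P₂ : ShimuraParametrizationData X₂ W₂'),
        P₂.IsMinimalFor W →
        P₁.deg * (cI P₁ p ^ 2 * cJ P₂ r ^ 2) =
          P₂.deg * ((W₁'.minimalDiscriminantNorm ℤ).factorization p *
            (W₂'.minimalDiscriminantNorm ℤ).factorization r))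
    (hJc : ∀ {N D M : ℕ}, IsAdmissibleFactorization N D M →
      ∀ (X : ShimuraCurveData D M) (W : WeierstrassCurve ℚ) [W.IsElliptic] [W.IsGloballyMinimal],
        W.conductorNorm ℤ = N →
      ∀ (W' : WeierstrassCurve ℚ) [W'.IsElliptic] (P : ShimuraParametrizationData X W'),
        P.IsMinimalFor W → ∀ p : ℕ, p.Prime → p ∣ D →
        cJ P p ∣ (W'.minimalDiscriminantNorm ℤ).factorization p)
    {S : Finset ℕ} (h2S : 2 ∈ S)
    (hEis : ∀ {N D M : ℕ}, IsAdmissibleFactorization N D M →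
      ∀ (X : ShimuraCurveData D M) (W : WeierstrassCurve ℚ) [W.IsElliptic] [W.IsGloballyMinimal],
        W.conductorNorm ℤ = N →
      ∀ (W' : WeierstrassCurve ℚ) [W'.IsElliptic] (P : ShimuraParametrizationData X W'),
        P.IsMinimalFor W → ∀ p : ℕ, p.Prime → p ∣ M → ¬ p ^ 2 ∣ M →
        ∀ r : ℕ, r.Prime → ¬ r ∣ N → (cI P p : ℤ) ∣ (r + 1 : ℤ) - W'.LFunction r)
    (h67 : ∀ ℓ : ℕ, ℓ.Prime → ∃ β : ℕ, (163 < ℓ → β = 1) ∧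
      ∀ (A : WeierstrassCurve ℚ) [A.IsElliptic],
        (∀ q : ℕ, q.Prime → q ∉ S → ¬ q ^ 2 ∣ A.conductorNorm ℤ) →
        ∀ r₀ : ℕ, ∃ r : ℕ, r₀ < r ∧ r.Prime ∧ ¬ ((ℓ ^ β : ℕ) : ℤ) ∣ (r + 1 : ℤ) - A.LFunction r)
    (h610 : ∀ L : ℕ, 7 ≤ L → {Δ : ℕ | ∃ (W : WeierstrassCurve ℚ) (_ : W.IsElliptic),
        (∀ q : ℕ, q.Prime → q ∉ S → ¬ q ^ 2 ∣ W.conductorNorm ℤ) ∧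
        W.minimalDiscriminantNorm ℤ = Δ ∧
        ∃ n k : ℕ, (∀ q : ℕ, q.Prime → q ∣ n → q ∈ S) ∧ Δ = n * k ^ L}.Finite)
    (h611 : ∀ ℓ : ℕ, ℓ.Prime → 11 ≤ ℓ → ∀ (W : WeierstrassCurve ℚ) [W.IsElliptic],
      W.IsSemistable ℤ → ∀ k : ℕ, 2 ≤ k → W.minimalDiscriminantNorm ℤ ≠ k ^ ℓ)
    (h612 : ∀ (W : WeierstrassCurve ℚ) [W.IsElliptic], IsFreyHellegouarch W →
      (∃ q : ℕ, q.Prime ∧ q ≠ 2 ∧ q ∣ W.conductorNorm ℤ) →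
      ∀ ℓ : ℕ, ℓ.Prime → 3 ≤ ℓ → ∀ k : ℕ, ordCompl[2] (W.minimalDiscriminantNorm ℤ) ≠ k ^ ℓ) :
    PastenShimura2024_thm_6_1_b :=
  PastenShimura2024_thm_6_1_b_of_ribetTakahashi_eisenstein_mazurKenku hMK hP
    (fun _ _ _ _ _ _ _ _ D₁ hf hmin _ _ _ hPm => hPm.deg_dvd_modularDegree D₁ hf hmin)
    cI cJ hI hJ h613 hJc h2S hEis h67 h610 h611 h612

end Literature.NumberTheory.Automorphic

end
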